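import Summits.CriticalPhenomena.PercolationContinuityZ3.Theses.PercNearOneGluing
import Literature.Probability.Percolation.PercolationProofs
import Literature.Probability.Percolation.ConditionalPositiveAssociationProofs
import Literature.Probability.Percolation.TwoClusterConditionalAssociationProofs
import Summits.CriticalPhenomena.PercolationContinuityZ3.Theorems.PercNearOneGluingAdditiveGluingGoodTwoRelays

/-! TTRL-lite variant V2095 of stmt-CriticalPhenomena-4576

(`stub_goodStep`, move `small_case+small_case`: `n ≤ 8` and `A.card = 2`).  With `b ∈ A` and
`A.card = 2` the relay set is `A = {a, b}` (one relay besides the target), so the additive gluing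
good step is the union bound through the unique relay `a`: the `sel W = b` pocket terms vanish
(`b ↔ b in Wᶜ` for `b ∉ W`), the `sel W = a` pocket terms decouple by the pocket Markov property
into `μ(C(o) = W, a ↮ b)`, and `{o ↔ A, o ↮ b} ⊆ {o ↔ a, a ↮ b}`; the pieces are disjoint
sub-events of `{a ↮ b}`, so the total is `≤ μ(a ↮ b) ≤ t`.  This is a special case of the
proved two-relay good step `stub_goodStepTwoRelays_k41` (`A.card ≤ 3`, any `n`); the size bound
`n ≤ 8`, the non-degeneracy hypothesis and the induction hypothesis are discarded.  No new
definitions, no named facts. -/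

namespace Summit.CriticalPhenomena.PercolationContinuityZ3.Theorems

open MeasureTheory Literature.Probability.LatticeModels Literature.Probability.Percolation
open scoped Classical BigOperators

/-- TTRL-lite variant V2095 of `stub_goodStep` (stmt-CriticalPhenomena-4576): the inductive step of
the good-quadruple inequality on at most eight vertices with a relay set of exactly two elements
(the target `b` and one relay).  Since `A.card = 2 ≤ 3`, this is a special case of the proved
two-relay good step `stub_goodStepTwoRelays_k41`; the bound `n ≤ 8`, the non-degeneracy and the
induction hypotheses are discarded. -/
theorem stub_goodStep_var2095 : ∀ (n : ℕ) (w : Sym2 (Fin n) → unitInterval) (A : Finset (Fin n)) (o b : Fin n), A.card = 2 → n ≤ 8 → b ∈ A → o ∉ A → (∃ y : Fin n, y ∉ A ∧ y ≠ o ∧ (w s(o, y) : ℝ) ≠ 0) → (∀ w' : Sym2 (Fin n) → unitInterval, (Finset.univ.filter (fun v : Fin n => ∃ u : Fin n, 0 < (w' s(u, v) : ℝ))).card < (Finset.univ.filter (fun v : Fin n => ∃ u : Fin n, 0 < (w s(u, v) : ℝ))).card → ∀ (A' : Finset (Fin n)) (o' b' : Fin n), b' ∈ A' → o' ∉ A'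 → ∀ (t : ℝ) (sel : Finset (Fin n) → Fin n), (∀ W, sel W ∈ A') → (∀ a ∈ A', 1 - t ≤ (prodBernoulli w').real (openConn a b')) → (prodBernoulli w').real ((⋃ a ∈ A', openConn o' a) ∩ (openConn o' b')ᶜ) + ∑ W ∈ (Finset.univ : Finset (Finset (Fin n))).filter (fun W => o' ∈ W ∧ Disjoint W A'), (prodBernoulli w').real {ω : BondConfig (Fin n) | openCluster ω o' = (W : Set (Fin n))} * (prodBernoulli w').real (openConnIn ((W : Set (Fin n))ᶜ) (sel W) b')ᶜ ≤ t) → ∀ (t : ℝ) (sel : Finset (Fin n) → Fin n), (∀ W, sel W ∈ A) → (∀ a ∈ A, 1 - t ≤ (prodBernoulli w).real (openConn a b)) → (prodBernoulli w).real ((⋃ a ∈ A, openConn o a) ∩ (openConn o b)ᶜ) + ∑ W ∈ (Finset.univ : Finset (Finset (Fin n))).filter (fun W => o ∈ W ∧ Disjoint W A), (prodBernoulli w).real {ω : BondConfig (Fin n) | openCluster ω o = (W : Set (Fin n))} * (prodBernoulli w).real (openConnIn ((W : Set (Fin n))ᶜ) (sel W) b)ᶜ ≤ t := by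
  intro n w A o b hcard _hn hbA hoA _hy _hIH t sel hsel hlev
  exact stub_goodStepTwoRelays_k41 n w A o b hbA hoA (le_trans hcard.le (by norm_num)) t sel hsel hlev

end Summit.CriticalPhenomena.PercolationContinuityZ3.Theorems
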